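import Literature.Geometry.Kaehler.StrataNbhdDescentDegOne
import Literature.AlgebraicGeometry.Motives.HodgeDecompositionIsInternalDischarge
import Literature.NumberTheory.Transcendental.ComplexFormsPullback
import Literature.AlgebraicGeometry.HodgeTheory.HodgeRiemannDegreeOneProofs
import HarnessLib

/-!
# A closed form whose restrictions to the strata are exact is exact near the configuration

Topic `Literature/Geometry/Kaehler`. The de Rham form of P. Deligne's *Théorie de Hodge III*,
Prop. 8.2.7 / Cor. 8.2.8 for a simple normal crossing configuration on a compact Kähler manifold,
by the direct route of P. Deligne, Ph. Griffiths, J. Morgan, D. Sullivan (1975), §5–§6 (the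
`∂∂̄`-lemma), assembled from the bricks of the programme recorded in
`Literature/AlgebraicGeometry/HodgeTheory/GysinKernelSplitRationalCore.lean`:

`StrataMaps.exists_nbhd_restr_mem_localExactForms_of_sres_mem_cexactSmoothForms`: let `M` be a
compact Kähler manifold, `T` a strata system over `M` with compact Kähler strata, embeddings
`emb_I` with `⋂_l emb (P_{J l}) ⊆ emb (P_J)`, and `ξ` a smooth closed complex `q`-form on `M`
whose pull-back to every stratum `P_{(i)}` is exact. Then `ξ` is exact on an open neighbourhood
of `⋃_i emb (P_i)`.

Proof. Hodge decomposition on `M` (`Motives.isInternal_hodgePQ_holds`): `ξ = Σ_{p+q'=q} ξ^{pq'} + dβ`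
with `ξ^{pq'}` closed of pure type (§1). On each stratum the classes `[emb^* ξ^{pq'}]` are of pure
type and sum to `[emb^* ξ] - [emb^* dβ] = 0`, hence vanish separately (independence of the Hodge
decomposition of the stratum, §1), i.e. every `emb^* ξ^{pq'}` is exact. For `p, q' ≥ 1` the strata
`∂∂̄`-cochain of `ξ^{pq'}` (`StrataDDbarDescent`, brick [B]) descends to a neighbourhood
(`StrataNbhdCechAssembly`, bricks [C]); for the edge types `(p, 0)`, `(0, q')` the exact pure
restrictions VANISH (`eq_zero_of_exact_of_isOfType_zero_right/left`, the `∂∂̄`-lemma at the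
edge), and the descent runs with the zero cochain (degree `≥ 2`: [C]; degree `1`:
`StrataNbhdDescentDegOne`; degree `0`: tautness directly). Intersecting the finitely many
neighbourhoods and adding `dβ` concludes. Everything is proved; no named facts (D-0026).

## References

* P. Deligne, *Théorie de Hodge III*, Publ. Math. IHÉS 44 (1974), Prop. 8.2.7, Cor. 8.2.8. [DeligneHodgeIII1974]
* P. Deligne, Ph. Griffiths, J. Morgan, D. Sullivan, *Real homotopy theory of Kähler manifolds*,
  Invent. Math. 29 (1975), §5 (the `dd^c`-lemma, 5.11) and §6. [DeligneGriffithsMorganSullivan1975]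
* C. Voisin, *Hodge Theory and Complex Algebraic Geometry I* (2002), Prop. 6.11, Prop. 6.17. [VoisinHodgeI2002]
* R. Bott, L. W. Tu, *Differential Forms in Algebraic Topology* (1982), §8, Prop. 8.8. [BottTu1982Forms]
-/

noncomputable section

open scoped Manifold ContDiff Topology
open Set Function Finset Literature.NumberTheory.Transcendental Literature.Geometry.Manifold
open _root_.Topology

universe u

namespace Literature.Geometry.Kaehler

set_option backward.isDefEq.respectTransparency false

/-! ### §1 Hodge decomposition of a closed form; independence of the types -/

section Hodge

variable {E : Type u} [NormedAddCommGroup E] [NormedSpace ℂ E] [FiniteDimensional ℂ E]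
  {M : Type u} [TopologicalSpace M] [ChartedSpace E M] [IsManifold 𝓘(ℂ, E) ω M]
  [IsManifold 𝓘(ℝ, E) ∞ M] [CompactSpace M] [T2Space M] [IsKaehlerManifold E M]

/-- **Hodge decomposition of a closed form** (Voisin I, Prop. 6.11, on forms): on a compact Kähler
manifold a closed smooth complex `k`-form is, modulo an exact form, a sum of closed forms of pure
types `(p, q)`, `p + q = k`. [cite: VoisinHodgeI2002, §6.1.3 Prop. 6.11] -/
theorem exists_sum_isOfType_sub_mem_cexactSmoothForms {k : ℕ} (ξ : cclosedSmoothForms E M k) :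
    ∃ θ : ℕ × ℕ → MForm 𝓘(ℝ, E) M ℂ k,
      (∀ pq, θ pq ∈ cclosedSmoothForms E M k) ∧
      (∀ pq ∈ antidiagonal k, IsOfType pq.1 pq.2 (θ pq)) ∧
      (ξ : MForm 𝓘(ℝ, E) M ℂ k) - ∑ pq ∈ antidiagonal k, θ pq ∈ cexactSmoothForms E M k := by
  classical
  have htop := Literature.AlgebraicGeometry.Motives.iSup_hodgePQ_eq_top (E := E) (M := M)
    Literature.AlgebraicGeometry.Motives.isInternal_hodgePQ_holds k
  have hc : complexDeRhamCohomology.mk E M k ξ ∈ ⨆ pq ∈ antidiagonal k, hodgePQ E M k pq.1 pq.2 := by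
    rw [htop]; trivial
  obtain ⟨μ, hμ⟩ := (Submodule.mem_iSup_finset_iff_exists_sum _ _).1 hc
  have hrep : ∀ pq : ℕ × ℕ, pq ∈ antidiagonal k → ∃ α : cclosedSmoothForms E M k,
      IsOfType pq.1 pq.2 (α : MForm 𝓘(ℝ, E) M ℂ k) ∧ complexDeRhamCohomology.mk E M k α = μ pq :=
    fun pq hpq ↦ Literature.AlgebraicGeometry.Motives.exists_isOfType_mk_eq_of_mem_hodgePQ
      (mem_antidiagonal.1 hpq) (μ pq).2
  choose α hαt hαμ using hrep
  let θ : ℕ × ℕ → cclosedSmoothForms E M k := fun pq ↦ if h : pq ∈ antidiagonal k then α pq h else 0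
  have hθ : ∀ pq (h : pq ∈ antidiagonal k), θ pq = α pq h := fun pq h ↦ dif_pos h
  refine ⟨fun pq ↦ (θ pq : MForm 𝓘(ℝ, E) M ℂ k), fun pq ↦ (θ pq).2, fun pq h ↦ ?_, ?_⟩
  · change IsOfType pq.1 pq.2 (θ pq : MForm 𝓘(ℝ, E) M ℂ k)
    rw [hθ pq h]; exact hαt pq h
  have hsum : complexDeRhamCohomology.mk E M k ξ =
      complexDeRhamCohomology.mk E M k (∑ pq ∈ antidiagonal k, θ pq) := by
    rw [map_sum, ← hμ]
    exact Finset.sum_congr rfl fun pq h ↦ by rw [hθ pq h, hαμ pq h]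
  have := (complexDeRhamCohomology.mk_eq_mk_iff _ _).1 hsum
  rwa [Submodule.coe_sum] at this

omit [FiniteDimensional ℂ E] [IsManifold 𝓘(ℂ, E) ω M] [IsManifold 𝓘(ℝ, E) ∞ M] [CompactSpace M]
  [T2Space M] [IsKaehlerManifold E M] in
/-- In an independent family of subspaces, a finite sum of members vanishes only if every summand
does. [folklore] -/
theorem eq_zero_of_sum_eq_zero_of_iSupIndep {V : Type*} [AddCommGroup V] [Module ℂ V] {κ : Type*}
    [Fintype κ] [DecidableEq κ] {A : κ → Submodule ℂ V} (hA : iSupIndep A) {x : κ → V}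
    (hx : ∀ i, x i ∈ A i) (h0 : ∑ i, x i = 0) (i : κ) : x i = 0 := by
  have hi : x i = -∑ j ∈ univ.erase i, x j := by
    rw [← Finset.add_sum_erase _ _ (mem_univ i)] at h0
    exact eq_neg_of_add_eq_zero_left h0
  have hmem : x i ∈ ⨆ (j) (_ : j ≠ i), A j := by
    rw [hi]
    refine Submodule.neg_mem _ (Submodule.sum_mem _ fun j hj ↦ ?_)
    exact Submodule.mem_iSup_of_mem j (Submodule.mem_iSup_of_mem (Finset.ne_of_mem_erase hj) (hx j))
  exact (Submodule.disjoint_def.1 (iSupIndep_def.1 hA i)) _ (hx i) hmem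

/-- **Independence of the Hodge types** (Voisin I, Prop. 6.11): on a compact Kähler manifold, if
closed forms `θ_{pq}` of pure types `(p, q)`, `p + q = k`, have classes summing to `0`, then every
`θ_{pq}` is exact. [cite: VoisinHodgeI2002, §6.1.3 Prop. 6.11] -/
theorem mem_cexactSmoothForms_of_sum_mk_eq_zero {k : ℕ} {θ : ℕ × ℕ → MForm 𝓘(ℝ, E) M ℂ k}
    (hθ : ∀ pq, θ pq ∈ cclosedSmoothForms E M k) (hθt : ∀ pq ∈ antidiagonal k, IsOfType pq.1 pq.2 (θ pq))
    (h0 : ∑ pq ∈ antidiagonal k, complexDeRhamCohomology.mk E M k ⟨θ pq, hθ pq⟩ = 0)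
    {pq : ℕ × ℕ} (hpq : pq ∈ antidiagonal k) : θ pq ∈ cexactSmoothForms E M k := by
  classical
  have hind := (Literature.AlgebraicGeometry.Motives.isInternal_hodgePQ_holds (E := E) (M := M) k).submodule_iSupIndep
  let x : ↥(antidiagonal k) → complexDeRhamCohomology E M k := fun i ↦
    complexDeRhamCohomology.mk E M k ⟨θ i.1, hθ i.1⟩
  have hx : ∀ i : ↥(antidiagonal k), x i ∈ hodgePQ E M k i.1.1 i.1.2 := fun i ↦
    Submodule.subset_span ⟨⟨θ i.1, hθ i.1⟩, hθt i.1 i.2, rfl⟩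
  have hsum : ∑ i : ↥(antidiagonal k), x i = 0 := by
    rw [← h0, ← Finset.sum_coe_sort (antidiagonal k)]
  have := eq_zero_of_sum_eq_zero_of_iSupIndep hind hx hsum ⟨pq, hpq⟩
  have h := (complexDeRhamCohomology.mk_eq_mk_iff (E := E) (M := M) ⟨θ pq, hθ pq⟩ 0).1
    (by rw [map_zero]; exact this)
  simpa using h

end Hodge

/-! ### §2 Pure-type restrictions to the strata -/

section Strata

variable {ι : Type} [DecidableEq ι]
  {EM : Type u} [NormedAddCommGroup EM] [NormedSpace ℂ EM] [FiniteDimensional ℂ EM]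
  {M : Type u} [TopologicalSpace M] [ChartedSpace EM M] [IsManifold 𝓘(ℂ, EM) ω M]
  [IsManifold 𝓘(ℝ, EM) ∞ M] [CompactSpace M] [T2Space M] [SecondCountableTopology M]
  [IsKaehlerManifold EM M]
  {EP : Finset ι → Type u} [∀ I, NormedAddCommGroup (EP I)] [∀ I, NormedSpace ℂ (EP I)]
  [∀ I, FiniteDimensional ℂ (EP I)]
  {P : Finset ι → Type u} [∀ I, TopologicalSpace (P I)] [∀ I, ChartedSpace (EP I) (P I)]
  [∀ I, IsManifold 𝓘(ℂ, EP I) ω (P I)] [∀ I, IsManifold 𝓘(ℝ, EP I) ∞ (P I)]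
  [∀ I, CompactSpace (P I)] [∀ I, T2Space (P I)] [∀ I, SecondCountableTopology (P I)]
  [∀ I, IsKaehlerManifold (EP I) (P I)]

namespace StrataMaps

variable (T : StrataMaps (EM := EM) M EP P)

omit [FiniteDimensional ℂ EM] [IsManifold 𝓘(ℂ, EM) ω M] [CompactSpace M] [T2Space M]
  [SecondCountableTopology M] [IsKaehlerManifold EM M] [∀ I, FiniteDimensional ℂ (EP I)]
  [∀ I, IsManifold 𝓘(ℂ, EP I) ω (P I)] [∀ I, CompactSpace (P I)] [∀ I, T2Space (P I)]
  [∀ I, SecondCountableTopology (P I)] [∀ I, IsKaehlerManifold (EP I) (P I)] in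
/-- The restriction of a closed form to a stratum is closed. [folklore] -/
theorem sres_mem_cclosedSmoothForms {k : ℕ} {x : MForm 𝓘(ℝ, EM) M ℂ k}
    (hx : x ∈ cclosedSmoothForms EM M k) (J : Fin 1 → ι) :
    T.sres x J ∈ cclosedSmoothForms (EP (tupleSupport J)) (P (tupleSupport J)) k :=
  pullback_mem_cclosedSmoothForms (T.contMDiff_emb _) hx

omit [FiniteDimensional ℂ EM] [IsManifold 𝓘(ℂ, EM) ω M] [CompactSpace M] [T2Space M]
  [SecondCountableTopology M] [IsKaehlerManifold EM M] [∀ I, FiniteDimensional ℂ (EP I)]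
  [∀ I, IsManifold 𝓘(ℂ, EP I) ω (P I)] [∀ I, CompactSpace (P I)] [∀ I, T2Space (P I)]
  [∀ I, SecondCountableTopology (P I)] [∀ I, IsKaehlerManifold (EP I) (P I)] in
/-- The restriction of an exact form to a stratum is exact. [folklore] -/
theorem sres_mem_cexactSmoothForms {k : ℕ} {x : MForm 𝓘(ℝ, EM) M ℂ k}
    (hx : x ∈ cexactSmoothForms EM M k) (J : Fin 1 → ι) :
    T.sres x J ∈ cexactSmoothForms (EP (tupleSupport J)) (P (tupleSupport J)) k :=
  pullback_mem_cexactSmoothForms (T.contMDiff_emb _) hx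

omit [FiniteDimensional ℂ EM] [IsManifold 𝓘(ℂ, EM) ω M] [CompactSpace M] [T2Space M]
  [SecondCountableTopology M] [IsKaehlerManifold EM M] [∀ I, SecondCountableTopology (P I)] in
/-- **Type splitting on the strata.** If `ξ - Σ θ_{pq}` is exact on `M`, the `θ_{pq}` closed of
pure types, and `emb_J^* ξ` is exact, then every `emb_J^* θ_{pq}` is exact (independence of the
Hodge decomposition of the compact Kähler stratum). [cite: VoisinHodgeI2002, §6.1.3 Prop. 6.11] -/
theorem sres_mem_cexactSmoothForms_of_types {k : ℕ} {ξ : MForm 𝓘(ℝ, EM) M ℂ k}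
    (hξ : ξ ∈ cclosedSmoothForms EM M k) {θ : ℕ × ℕ → MForm 𝓘(ℝ, EM) M ℂ k}
    (hθ : ∀ pq, θ pq ∈ cclosedSmoothForms EM M k) (hθt : ∀ pq ∈ antidiagonal k, IsOfType pq.1 pq.2 (θ pq))
    (hdiff : ξ - ∑ pq ∈ antidiagonal k, θ pq ∈ cexactSmoothForms EM M k) (J : Fin 1 → ι)
    (hJ : T.sres ξ J ∈ cexactSmoothForms (EP (tupleSupport J)) (P (tupleSupport J)) k)
    {pq : ℕ × ℕ} (hpq : pq ∈ antidiagonal k) :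
    T.sres (θ pq) J ∈ cexactSmoothForms (EP (tupleSupport J)) (P (tupleSupport J)) k := by
  classical
  set E' := EP (tupleSupport J)
  set N := P (tupleSupport J)
  have hθ' : ∀ pq, T.sres (θ pq) J ∈ cclosedSmoothForms E' N k := fun pq ↦ T.sres_mem_cclosedSmoothForms (hθ pq) J
  refine mem_cexactSmoothForms_of_sum_mk_eq_zero (E := E') (M := N) hθ'
    (fun pq h ↦ T.isOfType_sres (hθt pq h) J) ?_ hpq
  -- `Σ [emb^* θ_pq] = [emb^* ξ] - [emb^*(ξ - Σ θ)] = 0`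
  have h1 : complexDeRhamCohomology.mk E' N k ⟨T.sres ξ J, T.sres_mem_cclosedSmoothForms hξ J⟩ = 0 := by
    have := (complexDeRhamCohomology.mk_eq_mk_iff (E := E') (M := N)
      ⟨T.sres ξ J, T.sres_mem_cclosedSmoothForms hξ J⟩ 0).2 (by simpa using hJ)
    rwa [map_zero] at this
  have hsum_closed : ∑ pq ∈ antidiagonal k, θ pq ∈ cclosedSmoothForms EM M k :=
    Submodule.sum_mem _ fun pq _ ↦ hθ pq
  have h2 : complexDeRhamCohomology.mk E' N k ⟨T.sres ξ J, T.sres_mem_cclosedSmoothForms hξ J⟩ =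
      complexDeRhamCohomology.mk E' N k
        ⟨T.sres (∑ pq ∈ antidiagonal k, θ pq) J, T.sres_mem_cclosedSmoothForms hsum_closed J⟩ := by
    refine (complexDeRhamCohomology.mk_eq_mk_iff _ _).2 ?_
    have := T.sres_mem_cexactSmoothForms hdiff J
    simpa [sres, MForm.pullback_sub'] using this
  rw [h2] at h1
  rw [← h1, ← map_sum]
  congr 1
  apply Subtype.ext
  simp only [Submodule.coe_sum, sres, pullback_sum]

/-! ### §3 The theorem -/

/-- **A closed form whose restrictions to the strata are exact is exact near the configuration**
(Deligne, *Hodge III*, Prop. 8.2.7 / Cor. 8.2.8 for a normal crossing configuration, in de Rham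
form, by the `∂∂̄` route of Deligne–Griffiths–Morgan–Sullivan (1975), §5–§6): for a strata system
with compact Kähler strata embedded in the compact Kähler manifold `M`, with
`⋂_l emb (P_{J l}) ⊆ emb (P_J)`, a smooth closed complex `q`-form on `M` whose pull-back to every
`P_{(i)}` is exact is exact on an open neighbourhood of `⋃_i emb (P_i)`.
[cite: DeligneHodgeIII1974, Prop. 8.2.7 and Cor. 8.2.8] [cite: DeligneGriffithsMorganSullivan1975, §5–§6]
[cite: VoisinHodgeI2002, Prop. 6.11 and Prop. 6.17] -/
theorem exists_nbhd_restr_mem_localExactForms_of_sres_mem_cexactSmoothForms [Fintype ι]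
    (hTe : ∀ I, IsEmbedding (T.emb I))
    (hTr : ∀ {n : ℕ} (J : Fin (n + 1) → ι),
      (⋂ l, Set.range (T.emb {J l})) ⊆ Set.range (T.emb (tupleSupport J)))
    {q : ℕ} {ξ : MForm 𝓘(ℝ, EM) M ℂ q} (hξ : ξ ∈ cclosedSmoothForms EM M q)
    (hex : ∀ J : Fin 1 → ι,
      T.sres ξ J ∈ cexactSmoothForms (EP (tupleSupport J)) (P (tupleSupport J)) q) :
    ∃ (Ω : Set M) (hΩ : IsOpen Ω), (⋃ i, Set.range (T.emb {i})) ⊆ Ω ∧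
      ξ.restr Ω ∈ localExactForms 𝓘(ℝ, EM) ℂ hΩ q := by
  classical
  have hξ' : IsSmoothForm ξ ∧ IsClosedForm ξ := (mem_cclosedSmoothForms_iff ξ).1 hξ
  rcases q with _ | q
  · -- degree `0`: the restrictions vanish, and so does `ξ` near the strata (tautness)
    have h0 : ∀ J : Fin 1 → ι, T.sres ξ J = 0 := fun J ↦ by
      have : T.sres ξ J ∈ (⊥ : Submodule ℂ _) := hex J
      exact (Submodule.mem_bot ℂ).1 this
    have hV : ∀ J : Fin 1 → ι, ∃ V : Set M, IsOpen V ∧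
        Set.range (T.emb (tupleSupport J)) ⊆ V ∧ ξ.restr V = 0 := by
      intro J
      obtain ⟨V, hV, -, hfV, hz⟩ := exists_nhd_restr_eq_zero_of_pullback_eq_zero_complex
        (T.contMDiff_emb _) (hTe _) isOpen_univ (fun y ↦ mem_univ _)
        (mem_localClosedForms_univ_of_mem_closedSmoothForms hξ') (h0 J)
      exact ⟨V, hV, hfV, hz⟩
    choose V hVo hVr hVz using hV
    refine ⟨⋃ i, V (fun _ ↦ i), isOpen_iUnion fun i ↦ hVo _, ?_, ?_⟩
    · refine Set.iUnion_mono fun i ↦ fun y hy ↦ ?_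
      exact hVr _ (hTr (fun _ : Fin 1 ↦ i) (Set.mem_iInter.2 fun _ ↦ hy))
    · have : ξ.restr (⋃ i, V (fun _ ↦ i)) = 0 := by
        funext y
        by_cases hy : y ∈ ⋃ i, V (fun _ ↦ i)
        · rw [MForm.restr_apply_of_mem _ hy]
          obtain ⟨i, hi⟩ := Set.mem_iUnion.1 hy
          have := congrFun (hVz (fun _ ↦ i)) y
          rwa [MForm.restr_apply_of_mem _ hi] at this
        · exact MForm.restr_apply_of_notMem _ hy
      rw [this]
      exact zero_mem _
  -- positive degree: Hodge decomposition of `ξ`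
  obtain ⟨θ, hθ, hθt, hdiff⟩ := exists_sum_isOfType_sub_mem_cexactSmoothForms (E := EM) (M := M) ⟨ξ, hξ⟩
  have hθex : ∀ (J : Fin 1 → ι) {pq : ℕ × ℕ}, pq ∈ HasAntidiagonal.antidiagonal (q + 1) →
      T.sres (θ pq) J ∈ cexactSmoothForms (EP (tupleSupport J)) (P (tupleSupport J)) (q + 1) :=
    fun J pq hpq ↦ T.sres_mem_cexactSmoothForms_of_types hξ hθ hθt hdiff J (hex J) hpq
  -- a neighbourhood for each type
  have hΩpq : ∀ pq ∈ HasAntidiagonal.antidiagonal (q + 1), ∃ (Ω : Set M) (hΩ : IsOpen Ω),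
      (⋃ i, Set.range (T.emb {i})) ⊆ Ω ∧ (θ pq).restr Ω ∈ localExactForms 𝓘(ℝ, EM) ℂ hΩ (q + 1) := by
    rintro ⟨p, q'⟩ hpq
    have hpq' : p + q' = q + 1 := HasAntidiagonal.mem_antidiagonal.1 hpq
    have hθc : IsSmoothForm (θ (p, q')) ∧ IsClosedForm (θ (p, q')) :=
      (mem_cclosedSmoothForms_iff _).1 (hθ (p, q'))
    have hθr : θ (p, q') ∈ closedSmoothForms 𝓘(ℝ, EM) M ℂ (q + 1) := hθc
    have htyp : IsOfType p q' (θ (p, q')) := hθt _ hpq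
    by_cases hedge : p = 0 ∨ q' = 0
    · -- edge types: the restrictions vanish identically
      have hz : ∀ J : Fin 1 → ι, T.sres (θ (p, q')) J = 0 := by
        intro J
        obtain ⟨α, hα, he⟩ := (mem_cexactSmoothForms_succ_iff _).1 (hθex J hpq)
        rcases hedge with rfl | rfl
        · obtain rfl : q' = q + 1 := by omega
          exact eq_zero_of_exact_of_isOfType_zero_left (T.isSmoothForm_sres hθc.1 J)
            (T.isOfType_sres htyp J) hα he
        · obtain rfl : p = q + 1 := by omega
          exact eq_zero_of_exact_of_isOfType_zero_right (T.isSmoothForm_sres hθc.1 J)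
            (T.isOfType_sres htyp J) hα he
      cases q with
      | zero =>
        exact StrataMaps.exists_nbhd_restr_mem_localExactForms_degOne (T := T) hTe hTr hθr hz
      | succ k =>
        refine T.exists_nbhd_restr_mem_localExactForms hTe hTr hθr 0
          (fun _ _ _ ↦ isSmoothForm_zero) ?_ ?_ ?_
        · intro J
          change mextDeriv 0 = T.sres _ J
          rw [mextDeriv_zero, hz J]
        · intro a b _ J
          change T.delta 0 J + _ • mextDeriv 0 = 0
          rw [delta_zero, mextDeriv_zero, Pi.zero_apply, smul_zero, add_zero]
        · intro J
          rfl
    · -- inner types `(p₀ + 1, q₀ + 1)`: the `∂∂̄`-descent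
      simp only [not_or] at hedge
      obtain ⟨p₀, rfl⟩ : ∃ p₀, p = p₀ + 1 := ⟨p - 1, by omega⟩
      obtain ⟨q₀, rfl⟩ : ∃ q₀, q' = q₀ + 1 := ⟨q' - 1, by omega⟩
      cases q with
      | zero => exact absurd hpq' (by omega)
      | succ k =>
        have hx' : ∀ J : Fin 1 → ι, ∃ α : MForm 𝓘(ℝ, EP (tupleSupport J)) (P (tupleSupport J)) ℂ (k + 1),
            IsSmoothForm α ∧ T.sres (θ (p₀ + 1, q₀ + 1)) J = mextDeriv α :=
          fun J ↦ (mem_cexactSmoothForms_succ_iff _).1 (hθex J hpq)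
        refine T.exists_nbhd_restr_mem_localExactForms hTe hTr hθr (T.eta hθc.1 htyp hx')
          (T.eta_smooth hθc.1 htyp hx') (T.mextDeriv_eta_zero hθc.1 htyp hx') ?_ ?_
        · intro a b hab J
          exact T.delta_eta_add hθc.1 htyp hx' a b hab J
        · intro J
          exact congrFun (T.eta_zero_right hθc.1 htyp hx' (k + 1)) J
  -- assembly: intersect the neighbourhoods and add the exact part
  choose Ωf hΩo hΩsub hΩex using hΩpq
  let Ω : Set M := ⋂ pq : ↥(HasAntidiagonal.antidiagonal (q + 1)), Ωf pq.1 pq.2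
  have hΩo' : IsOpen Ω := isOpen_iInter_of_finite fun pq ↦ hΩo pq.1 pq.2
  refine ⟨Ω, hΩo', Set.subset_iInter fun pq ↦ hΩsub pq.1 pq.2, ?_⟩
  obtain ⟨β, hβ, hβe⟩ := (mem_cexactSmoothForms_succ_iff _).1 hdiff
  have e : ξ = mextDeriv β + ∑ pq ∈ HasAntidiagonal.antidiagonal (q + 1), θ pq := by
    rw [← hβe]; abel
  rw [e, MForm.restr_add, MForm.restr_sum]
  refine add_mem ?_ (Submodule.sum_mem _ fun pq hpq ↦ ?_)
  · refine (mem_localExactForms_succ_iff hΩo').2 ⟨⟨β.restr Ω, restr_mem_smoothFormsOn hΩo'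
      (subset_univ _) (by rw [smoothFormsOn_univ]; exact (mem_smoothForms_iff β).2 hβ)⟩, ?_⟩
    rw [coe_localD]
    funext y
    by_cases hy : y ∈ Ω
    · rw [MForm.restr_apply_of_mem _ hy, MForm.restr_apply_of_mem _ hy, mextDeriv_restr_apply hΩo' _ hy]
    · rw [MForm.restr_apply_of_notMem _ hy, MForm.restr_apply_of_notMem _ hy]
  · have hsub : Ω ⊆ Ωf pq hpq := Set.iInter_subset (fun i : ↥(HasAntidiagonal.antidiagonal (q + 1)) ↦ Ωf i.1 i.2) ⟨pq, hpq⟩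
    have := restr_mem_localExactForms hΩo' (hΩo pq hpq) hsub (hΩex pq hpq)
    rwa [MForm.restr_restr_of_subset hsub] at this

end StrataMaps

end Strata

end Literature.Geometry.Kaehler

end
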